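import Literature.NumberTheory.LFunctions.VinogradovKorobovLargeHeightWith
import Literature.NumberTheory.LFunctions.FordZetaBound747
import HarnessLib

/-!
# The large-height region of Mossinghoff–Trudgian–Yang from Ford's exponential-sum bound (Theorem 2)

Topic `Literature/NumberTheory/LFunctions`, family RH (explicit Vinogradov–Korobov zero-free
regions). Everything in this file is PROVED; no definition, no named fact; the exponential-sum
bound is a displayed HYPOTHESIS (the same three shapes as in `FordZetaBoundMain.lean` /
`FordZetaBoundMain12.lean`, where it is the one unproved input of the named fact
`zeta_bound_ford`), never assumed as a fact.

Composition of `zero_bound_large_height_of_zeta_bound` (`VinogradovKorobovLargeHeightWith.lean`: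
the named fact `Literature.NumberTheory.LFunctions.zero_bound_large_height_mossinghoff_trudgian_yang`
— §5 of Mossinghoff–Trudgian–Yang, arXiv:2212.06867: `Z(β, t) ≥ 0.048976` for every zero with
`t ≥ exp 52238` — from any bound `|ζ(σ + it)| ≤ A t^{4.45(1−σ)^{3/2}} (log t)^{2/3}`, `t ≥ 3`,
`1/2 ≤ σ ≤ 1`, with `6.5 < A ≤ 74.9`, all other inputs being theorems of the tree) with
`zeta_bound747_of_exp_sum_bound*` (`FordZetaBound747.lean`: such a bound with `A = 74.7` from
Ford's Theorem 2, Proc. LMS 85 (2002)). Hence the honest reduction of the fact, recorded here: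

* `zero_bound_large_height_of_exp_sum_bound` — **from Ford's Theorem 2 as printed**
  (`S(N, t) ≤ 9.463 N^{1−1/(133.66λ²)}`, `0 < u ≤ 1`, `1 ≤ N ≤ t`);
* `zero_bound_large_height_of_exp_sum_bound12` — from the weaker bound with constant `12`;
* `zero_bound_large_height_of_exp_sum_bound12_large_lambda` — from the constant-`12` bound for
  `λ = log t/log N ≥ 8` only (the range `λ ≤ 8` is the theorem `FordVK.expSum_bound_small_lambda`).

Why not simply `zeta_bound_ford → fact`: the printed §5 uses Lemma 4.7 with the constant `0.213`,
which rests on the mis-derived constant `0.479` of MTY Lemma 4.5 (= Ford 2000, Lemma 4.2); with the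
justified constant (`zero_inequality_mossinghoff_trudgian_yang_corrected`) the printed final
inequality (5.15) fails at `A = 76.2` by `1.8·10⁻⁵` and holds for `A ≤ 74.9`
(`VinogradovKorobovLargeHeightWith.lean`, module docstring). Ford's deduction Theorem 2 ⟹ Theorem 1
certifies `74.7`, so nothing is lost at the level of Theorem 2.

## References

* M. J. Mossinghoff, T. S. Trudgian, A. Yang, *Explicit zero-free regions for the Riemann
  zeta-function*, Res. Number Theory 10 (2024) = arXiv:2212.06867: §5, Lemmas 4.5–4.7, (3.1).
  [MossinghoffTrudgianYangRNT2024]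
* K. Ford, *Vinogradov's integral and bounds for the Riemann zeta function*, Proc. London Math.
  Soc. (3) 85 (2002), 565–633: Theorems 1–2, §7. [Ford2002]
-/

noncomputable section

open Complex Real

namespace Literature.NumberTheory.LFunctions

/-- **The large-height region of MTY (§5, `M ≥ M₁ = 0.048976` for `t ≥ exp 52238`) from Ford's
Theorem 2 as printed**: if `‖∑_{N < n ≤ R} (n + u)^{−it}‖ ≤ 9.463 N^{1 − (log N)²/(133.66 (log t)²)}`
for all integers `1 ≤ N < R ≤ 2N` and reals `t ≥ N`, `0 < u ≤ 1`, then
`zero_bound_large_height_mossinghoff_trudgian_yang`. (`zeta_bound747_of_exp_sum_bound`: the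
hypothesis gives Ford's Theorem 1 with `A = 74.7`; `zero_bound_large_height_of_zeta_bound`:
§5 with the corrected Lemma 4.7 closes for `A ≤ 74.9`.)
[cite: MossinghoffTrudgianYangRNT2024, §5] [cite: Ford2002, Theorems 1–2] -/
theorem zero_bound_large_height_of_exp_sum_bound
    (hT2 : ∀ (N R : ℕ) (t u : ℝ), 1 ≤ N → (N : ℝ) ≤ t → 0 < u → u ≤ 1 → N < R → R ≤ 2 * N →
      ‖∑ n ∈ Finset.Ioc N R, ((n : ℂ) + u) ^ (-(t * I))‖
        ≤ 9.463 * (N : ℝ) ^ (1 - Real.log N ^ 2 / (133.66 * Real.log t ^ 2))) :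
    zero_bound_large_height_mossinghoff_trudgian_yang :=
  zero_bound_large_height_of_zeta_bound (by norm_num) (by norm_num) (zeta_bound747_of_exp_sum_bound hT2)

/-- **The same from the exponential-sum bound with constant `12`** (in place of `9.463`).
[cite: MossinghoffTrudgianYangRNT2024, §5] [cite: Ford2002, Theorems 1–2] -/
theorem zero_bound_large_height_of_exp_sum_bound12
    (hT2 : ∀ (N R : ℕ) (t u : ℝ), 1 ≤ N → (N : ℝ) ≤ t → 0 < u → u ≤ 1 → N < R → R ≤ 2 * N →
      ‖∑ n ∈ Finset.Ioc N R, ((n : ℂ) + u) ^ (-(t * I))‖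
        ≤ 12 * (N : ℝ) ^ (1 - Real.log N ^ 2 / (133.66 * Real.log t ^ 2))) :
    zero_bound_large_height_mossinghoff_trudgian_yang :=
  zero_bound_large_height_of_zeta_bound (by norm_num) (by norm_num)
    (zeta_bound747_of_exp_sum_bound12 hT2)

/-- **The same from the constant-`12` bound for `λ ≥ 8` only** (`t ≥ N⁸`; the range `λ ≤ 8` is
`FordVK.expSum_bound_small_lambda`). This is the weakest exponential-sum hypothesis in the tree
from which `zeta_bound_ford` is derived (`zeta_bound_ford_of_exp_sum_bound12_large_lambda`); the
named fact `zero_bound_large_height_mossinghoff_trudgian_yang` follows from the same hypothesis.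
[cite: MossinghoffTrudgianYangRNT2024, §5] [cite: Ford2002, Theorems 1–2] -/
theorem zero_bound_large_height_of_exp_sum_bound12_large_lambda
    (hT2 : ∀ (N R : ℕ) (t u : ℝ), 1 ≤ N → (N : ℝ) ^ 8 ≤ t → 0 < u → u ≤ 1 → N < R → R ≤ 2 * N →
      ‖∑ n ∈ Finset.Ioc N R, ((n : ℂ) + u) ^ (-(t * Complex.I))‖
        ≤ 12 * (N : ℝ) ^ (1 - Real.log N ^ 2 / (133.66 * Real.log t ^ 2))) :
    zero_bound_large_height_mossinghoff_trudgian_yang :=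
  zero_bound_large_height_of_zeta_bound (by norm_num) (by norm_num)
    (zeta_bound747_of_exp_sum_bound12_large_lambda hT2)

/-- **The honest status of rh.S10's large-height input, in one line**: the exponential-sum bound
with constant `12` for `λ ≥ 8` implies BOTH Ford's (3.1) as printed (`zeta_bound_ford`) AND the
large-height region (`zero_bound_large_height_mossinghoff_trudgian_yang`).
[cite: Ford2002, Theorems 1–2] [cite: MossinghoffTrudgianYangRNT2024, §5] -/
theorem zeta_bound_ford_and_zero_bound_large_height_of_exp_sum_bound12_large_lambda
    (hT2 : ∀ (N R : ℕ) (t u : ℝ), 1 ≤ N → (N : ℝ) ^ 8 ≤ t → 0 < u → u ≤ 1 → N < R → R ≤ 2 * N →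
      ‖∑ n ∈ Finset.Ioc N R, ((n : ℂ) + u) ^ (-(t * Complex.I))‖
        ≤ 12 * (N : ℝ) ^ (1 - Real.log N ^ 2 / (133.66 * Real.log t ^ 2))) :
    zeta_bound_ford ∧ zero_bound_large_height_mossinghoff_trudgian_yang :=
  ⟨zeta_bound_ford_of_exp_sum_bound12_large_lambda hT2,
    zero_bound_large_height_of_exp_sum_bound12_large_lambda hT2⟩

/-- **rh.S10 from Theorem 1.3 and Ford's exponential-sum bound.** The Vinogradov–Korobov region
with the printed constant `55.241` for `|t| ≥ 3` (`zero_free_region_vinogradov_korobov`, MTY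
Theorem 1.1) follows from MTY Theorem 1.3 (`zero_free_region_mossinghoff_trudgian_yang`, the
classical region `1/(5.558691 log|t|)`, a named fact: its printed proof uses the verification of RH
up to `3·10¹²`) and the constant-`12`, `λ ≥ 8` exponential-sum bound — Theorem 1.4 being proved
(`zero_free_region_intermediate_mossinghoff_trudgian_yang_holds`) and the large-height part being
`zero_bound_large_height_of_exp_sum_bound12_large_lambda` (`zero_free_region_vinogradov_korobov_of_parts`).
[cite: MossinghoffTrudgianYangRNT2024, Theorem 1.1 (proof, §5)] [cite: Ford2002, Theorem 2] -/
theorem zero_free_region_vinogradov_korobov_of_classical_and_exp_sum_bound12_large_lambda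
    (hC : zero_free_region_mossinghoff_trudgian_yang)
    (hT2 : ∀ (N R : ℕ) (t u : ℝ), 1 ≤ N → (N : ℝ) ^ 8 ≤ t → 0 < u → u ≤ 1 → N < R → R ≤ 2 * N →
      ‖∑ n ∈ Finset.Ioc N R, ((n : ℂ) + u) ^ (-(t * Complex.I))‖
        ≤ 12 * (N : ℝ) ^ (1 - Real.log N ^ 2 / (133.66 * Real.log t ^ 2))) :
    zero_free_region_vinogradov_korobov :=
  zero_free_region_vinogradov_korobov_of_parts hC
    zero_free_region_intermediate_mossinghoff_trudgian_yang_holds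
    (zero_bound_large_height_of_exp_sum_bound12_large_lambda hT2)

end Literature.NumberTheory.LFunctions
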